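import Mathlib
import Literature.MathematicalPhysics.QuantumLattice.WilsonDiracAP

/-!
# Counting the corner box of the `M⁴` block twists
(helper for crux stmt-QuantumFields-9734, line `Sketch`, stub `stub_cornerCounting`)

What.  The `M⁴` Bloch blocks of the `2M`-torus carry twists `θ_k = (π k_μ / M + π / (2M))_{μ<4}`,
`k ∈ (Fin M)⁴`.  The *corner box* consists of the `k` all four of whose coordinates satisfy
`min (θ, π - θ) < 1/20`.  We prove that for `M ≥ 1000` it has at most `M⁴ / 500000` elements.

How.  Elementary counting, no physics.  The corner box is the product set `T′⁴`
(`Fintype.piFinset`) with `T′ = {j : min (θ_j, π - θ_j) < 1/20}`, so its cardinality is `b′⁴`,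
`b′ = #T′`.  For a general radius `ρ ∈ (0, π]` the one-sided count `#{j : θ_j < ρ}` equals
`⌈ρM/π - 1/2⌉₊ ∈ [ρM/π - 1/2, ρM/π + 1/2)` (`CornerCounting.card_filter_twist_lt_radius`:
`θ_j < ρ ↔ j < ρM/π - 1/2`, `Nat.lt_ceil`), the other side is its mirror image under `Fin.rev`
(`θ_{rev j} = π - θ_j`) and the two sides are disjoint when `2ρ ≤ π`, whence
`b′ ∈ [2ρM/π - 1, 2ρM/π + 1)` (`CornerCounting.card_twist_near_radius`).  With `ρ = 1/20`,
`π > 3.14` and `M ≥ 1000` this gives `b′ ≤ 0.033 M`, and `0.033⁴ ≤ 1/500000`.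
Sources: folklore; Mathlib only (the radius-`1/2` versions are in the sibling file
`…StubTwistCounting`).  Pure theorem file.
-/

noncomputable section

open scoped BigOperators Classical Matrix ComplexConjugate
open Finset
open Literature.MathematicalPhysics.QuantumLattice Literature.MathematicalPhysics.QuantumFieldTheory
  Literature.Probability.LatticeModels

namespace Summit.QuantumFields.QCD.Cruxes.CriticalLineDiamagnetism.ChessboardCellGain

namespace CornerCounting

/-- One-sided count with a general radius `ρ ∈ (0, π]`:
`#{j < M : π j / M + π/(2M) < ρ}` lies in `[ρM/π - 1/2, ρM/π + 1/2)`. -/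
theorem card_filter_twist_lt_radius (M : ℕ) (hM : 0 < M) (ρ : ℝ) (hρ : 0 < ρ)
    (hρπ : ρ ≤ Real.pi) :
    ρ * M / Real.pi - 1 / 2
        ≤ ((univ.filter fun j : Fin M =>
            Real.pi * ((j : ℕ) : ℝ) / M + Real.pi / (2 * M) < ρ).card : ℝ) ∧
    ((univ.filter fun j : Fin M =>
        Real.pi * ((j : ℕ) : ℝ) / M + Real.pi / (2 * M) < ρ).card : ℝ)
        < ρ * M / Real.pi + 1 / 2 := by
  set c : ℝ := ρ * M / Real.pi - 1 / 2 with hc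
  have hMpos : (0 : ℝ) < M := by exact_mod_cast hM
  have hMne : (M : ℝ) ≠ 0 := hMpos.ne'
  have hπpos := Real.pi_pos
  have hπne : Real.pi ≠ 0 := Real.pi_ne_zero
  have hcM : ⌈c⌉₊ ≤ M := by
    refine Nat.ceil_le.2 ?_
    have : ρ * M / Real.pi ≤ M := by
      rw [div_le_iff₀ hπpos]
      calc ρ * M ≤ Real.pi * M := mul_le_mul_of_nonneg_right hρπ hMpos.le
        _ = M * Real.pi := mul_comm _ _
    rw [hc]
    linarith
  have key : ∀ x : ℝ, Real.pi * x / M + Real.pi / (2 * M) < ρ ↔ x < c := by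
    intro x
    have e : Real.pi * x / M + Real.pi / (2 * M) = ρ - Real.pi / M * (c - x) := by
      rw [hc]
      field_simp
      ring
    rw [e, sub_lt_self_iff, mul_pos_iff_of_pos_left (by positivity), sub_pos]
  have hset : (univ.filter fun j : Fin M =>
        Real.pi * ((j : ℕ) : ℝ) / M + Real.pi / (2 * M) < ρ)
      = (range ⌈c⌉₊).attachFin (fun m hm => lt_of_lt_of_le (mem_range.1 hm) hcM) := by
    ext j
    simp only [mem_filter, mem_univ, true_and, mem_attachFin, mem_range, key, Nat.lt_ceil]
  rw [hset, card_attachFin, card_range]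
  refine ⟨Nat.le_ceil c, ?_⟩
  rcases le_or_gt 0 c with hc0 | hc0
  · exact (Nat.ceil_lt_add_one hc0).trans_eq (by rw [hc]; ring)
  · rw [Nat.ceil_eq_zero.2 hc0.le, Nat.cast_zero]
    positivity

/-- Two-sided count with a general radius `ρ > 0`, `2ρ ≤ π`:
`b′ = #{j < M : min (θ_j, π - θ_j) < ρ}` lies in `[2ρM/π - 1, 2ρM/π + 1)`
(the two sides are mirror images under `Fin.rev` and disjoint). -/
theorem card_twist_near_radius (M : ℕ) (hM : 0 < M) (ρ : ℝ) (hρ : 0 < ρ)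
    (hρπ : 2 * ρ ≤ Real.pi) :
    2 * ρ * M / Real.pi - 1
        ≤ ((univ.filter fun j : Fin M =>
            min (Real.pi * ((j : ℕ) : ℝ) / M + Real.pi / (2 * M))
              (Real.pi - (Real.pi * ((j : ℕ) : ℝ) / M + Real.pi / (2 * M))) < ρ).card : ℝ) ∧
    ((univ.filter fun j : Fin M =>
        min (Real.pi * ((j : ℕ) : ℝ) / M + Real.pi / (2 * M))
          (Real.pi - (Real.pi * ((j : ℕ) : ℝ) / M + Real.pi / (2 * M))) < ρ).card : ℝ)
        < 2 * ρ * M / Real.pi + 1 := by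
  have hMpos : (0 : ℝ) < M := by exact_mod_cast hM
  have hMne : (M : ℝ) ≠ 0 := hMpos.ne'
  have hrev : ∀ j : Fin M, Real.pi * (((Fin.rev j : Fin M) : ℕ) : ℝ) / M + Real.pi / (2 * M)
      = Real.pi - (Real.pi * ((j : ℕ) : ℝ) / M + Real.pi / (2 * M)) := by
    intro j
    have hj : (j : ℕ) + 1 ≤ M := j.isLt
    rw [Fin.val_rev, Nat.cast_sub hj, Nat.cast_add, Nat.cast_one]
    field_simp
    ring
  have hsplit : (univ.filter fun j : Fin M =>
        min (Real.pi * ((j : ℕ) : ℝ) / M + Real.pi / (2 * M))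
          (Real.pi - (Real.pi * ((j : ℕ) : ℝ) / M + Real.pi / (2 * M))) < ρ)
      = (univ.filter fun j : Fin M => Real.pi * ((j : ℕ) : ℝ) / M + Real.pi / (2 * M) < ρ) ∪
        (univ.filter fun j : Fin M =>
          Real.pi - (Real.pi * ((j : ℕ) : ℝ) / M + Real.pi / (2 * M)) < ρ) := by
    ext j
    simp only [mem_filter, mem_univ, true_and, mem_union, min_lt_iff]
  have hdisj : Disjoint
      (univ.filter fun j : Fin M => Real.pi * ((j : ℕ) : ℝ) / M + Real.pi / (2 * M) < ρ)
      (univ.filter fun j : Fin M =>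
        Real.pi - (Real.pi * ((j : ℕ) : ℝ) / M + Real.pi / (2 * M)) < ρ) := by
    rw [Finset.disjoint_filter]
    intro j _ h1 h2
    linarith
  have hsymm : (univ.filter fun j : Fin M =>
        Real.pi - (Real.pi * ((j : ℕ) : ℝ) / M + Real.pi / (2 * M)) < ρ).card
      = (univ.filter fun j : Fin M =>
          Real.pi * ((j : ℕ) : ℝ) / M + Real.pi / (2 * M) < ρ).card := by
    refine Finset.card_equiv Fin.revPerm (fun j => ?_)
    simp only [mem_filter, mem_univ, true_and, Fin.revPerm_apply]
    rw [hrev]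
  rw [hsplit, card_union_of_disjoint hdisj, hsymm, Nat.cast_add]
  obtain ⟨h1, h2⟩ := card_filter_twist_lt_radius M hM ρ hρ (by linarith)
  have e : 2 * ρ * M / Real.pi = 2 * (ρ * M / Real.pi) := by ring
  constructor <;> linarith

end CornerCounting

/-- **Stub — `cornerCounting` (v16 corner-box count).**  For `M ≥ 1000` the block twists
`θ_k = (π k_μ / M + π/(2M))_μ`, `k ∈ (Fin M)⁴`, all four of whose coordinates are within `1/20`
of `{0, π}` number at most `M⁴ / 500000`.
Proof: the set is the product `T′⁴` with `#T′ < M/(10π) + 1 ≤ 0.033 M`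
(`CornerCounting.card_twist_near_radius` with `ρ = 1/20`), and `0.033⁴ ≤ 1/500000`. -/
theorem stub_cornerCounting : ∃ M₂ : ℕ, ∀ (M : ℕ) [NeZero M], M₂ ≤ M → ((Finset.univ.filter (fun k : Fin 4 → Fin M => ∀ μ : Fin 4, min (Real.pi * ((k μ : ℕ) : ℝ) / M + Real.pi / (2 * M)) (Real.pi - (Real.pi * ((k μ : ℕ) : ℝ) / M + Real.pi / (2 * M))) < 1 / 20)).card : ℝ) ≤ (1 / 500000 : ℝ) * (M : ℝ) ^ 4 := by
  refine ⟨1000, ?_⟩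
  intro M _ hM
  have hM0 : 0 < M := by omega
  have hM' : (1000 : ℝ) ≤ M := by exact_mod_cast hM
  have hset : (univ.filter fun k : Fin 4 → Fin M => ∀ μ : Fin 4,
        min (Real.pi * ((k μ : ℕ) : ℝ) / M + Real.pi / (2 * M))
          (Real.pi - (Real.pi * ((k μ : ℕ) : ℝ) / M + Real.pi / (2 * M))) < 1 / 20)
      = Fintype.piFinset (fun _ : Fin 4 => univ.filter fun j : Fin M =>
          min (Real.pi * ((j : ℕ) : ℝ) / M + Real.pi / (2 * M))
            (Real.pi - (Real.pi * ((j : ℕ) : ℝ) / M + Real.pi / (2 * M))) < 1 / 20) := by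
    ext k
    simp only [mem_filter, mem_univ, true_and, Fintype.mem_piFinset]
  rw [hset, Fintype.card_piFinset_const]
  obtain ⟨-, hhi⟩ := CornerCounting.card_twist_near_radius M hM0 (1 / 20) (by norm_num)
    (by linarith [Real.pi_gt_three])
  have hπ := Real.pi_gt_d2
  have hdiv : 2 * (1 / 20 : ℝ) * M / Real.pi ≤ 2 * (1 / 20 : ℝ) * M / 3.14 :=
    div_le_div_of_nonneg_left (by positivity) (by norm_num) hπ.le
  have hlin : 2 * (1 / 20 : ℝ) * M / 3.14 ≤ 0.033 * M - 1 := by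
    rw [div_le_iff₀ (by norm_num)]
    linarith
  have hb : ((univ.filter fun j : Fin M =>
      min (Real.pi * ((j : ℕ) : ℝ) / M + Real.pi / (2 * M))
        (Real.pi - (Real.pi * ((j : ℕ) : ℝ) / M + Real.pi / (2 * M))) < 1 / 20).card : ℝ)
      ≤ 0.033 * M := by
    linarith
  push_cast
  calc ((univ.filter fun j : Fin M =>
        min (Real.pi * ((j : ℕ) : ℝ) / M + Real.pi / (2 * M))
          (Real.pi - (Real.pi * ((j : ℕ) : ℝ) / M + Real.pi / (2 * M))) < 1 / 20).card : ℝ) ^ 4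
      ≤ (0.033 * M) ^ 4 := pow_le_pow_left₀ (Nat.cast_nonneg _) hb 4
    _ = 0.033 ^ 4 * (M : ℝ) ^ 4 := mul_pow _ _ _
    _ ≤ (1 / 500000 : ℝ) * (M : ℝ) ^ 4 := mul_le_mul_of_nonneg_right (by norm_num) (by positivity)

end Summit.QuantumFields.QCD.Cruxes.CriticalLineDiamagnetism.ChessboardCellGain
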